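import Literature.MathematicalPhysics.QuantumLattice.HubbardModel
import Literature.MathematicalPhysics.QuantumLattice.HubbardRectangularTorus
import Literature.MathematicalPhysics.QuantumLattice.HubbardBootstrapCertificate
import Literature.MathematicalPhysics.QuantumLattice.HubbardBootstrapCertificateResidual
import Literature.MathematicalPhysics.QuantumLattice.HeisenbergModel
import Literature.MathematicalPhysics.QuantumLattice.HubbardSpinChargeCertificate
import Literature.MathematicalPhysics.QuantumLattice.SectorGroundState
import Literature.MathematicalPhysics.QuantumLattice.HubbardTorusLocalCertificate
import Literature.MathematicalPhysics.QuantumLattice.HubbardTorus2DEnergyDensity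
import Literature.MathematicalPhysics.QuantumLattice.HubbardWindowCertificateD4
import Literature.MathematicalPhysics.QuantumLattice.HubbardCorrelatorCertificate
import Literature.MathematicalPhysics.QuantumLattice.HubbardCorrelatorCertificateAffine
import Literature.MathematicalPhysics.QuantumLattice.HubbardChainDoubleOccupancyLiebWu
import Literature.MathematicalPhysics.QuantumLattice.HubbardKineticEnergyDensity
import Literature.MathematicalPhysics.QuantumLattice.HeisenbergWindowCertificateSquare
import Literature.MathematicalPhysics.QuantumLattice.HubbardTorusLimitSpinCorrelationSign
import Literature.MathematicalPhysics.QuantumLattice.HubbardTorusChargeGapSpinGap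
import Literature.MathematicalPhysics.QuantumLattice.HubbardSzSectorMonotone
import Literature.MathematicalPhysics.QuantumLattice.HubbardHalfFilledSectorOrdering
import Literature.MathematicalPhysics.QuantumLattice.HubbardRingPerronFrobeniusProofs
import Literature.MathematicalPhysics.QuantumLattice.HubbardSectorCorrelatorCertificate
import HarnessLib
import HarnessLib.Audit
import Summits.HubbardSuperconductivity.ManyBodyBootstrap.Bounds.Defs
import Summits.HubbardSuperconductivity.ManyBodyBootstrap.Bounds.SdpRows3
import Summits.HubbardSuperconductivity.ManyBodyBootstrap.Bounds.SdpRows4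
import Summits.HubbardSuperconductivity.ManyBodyBootstrap.Bounds.Corollaries1

/-!
# Many-body bootstrap — Bounds: kernel-checked corollaries — kinetic brackets from the R3 rows (gen 105) and the kinetic bridge (gen 111)

Part `Corollaries2` (8/12) of the cell's staged module `HubbardCertifiedBounds.lean` (sha256 `f0c9b0b3b0eb4516…`), filed under the
cell topic `ManyBodyBootstrap` (lit seat pub-mbboot, tool `file_parts_g19.py`; unit→part table in HOME/PLACEMENT.md).
Declarations are the staged ones, byte-identical up to: namespace `Summit.HubbardSuperconductivity.Bounds` → `Summit.HubbardSuperconductivity.ManyBodyBootstrap.Bounds`,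
`@[conjecture]` on every certificate CLAIM NODE (`def … : Prop`, an open obligation node closable in-kernel from the
certificate's exact data — NOT a vendored fact) and a closing `[computation: <format>, exact ℚ]` tag in its docstring.
Scope, provenance, certificate formats, verifiers and the PROVED soundness theorems are stated in the module docstring of
part `Defs` and in each row's docstring. HONEST FRAMING: certified numerical bounds on a lattice model; not
superconductivity, not a phase diagram.
-/

noncomputable section

namespace Summit.HubbardSuperconductivity.ManyBodyBootstrap.Bounds

open Literature.MathematicalPhysics.QuantumLattice
open Literature.Probability.LatticeModels
open Filter Topology HubbardWave0 Literature.MathematicalPhysics.QuantumManyBody.StateRelaxation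
open scoped Matrix

/-! ## gen-105 corollaries: KINETIC energy density re-instantiated on the R3-base rows (typer g105, 2026-08-20)

Every theorem below is fully proved (zero admits); same glue and same window expression as `Gen104KineticCorollaries`
(`IsTorusLimitOf.neg_t_mul_re_expect_hoppingWindow_{le_of_le_docc,ge_of_docc_le}`, HubbardKineticEnergyDensity.lean, p197578).
NEW inputs since gen 104 (sdp1-g3, index.json 118 rows): (i) the R3-base TL energy floors `sdp_lower_TL_hubSQ_w3_U{2,6,12}_R3b4eom_ob3p`
(kit j071226 / j071227 / j071228; e ≥ −1.2468015 / −0.7569758 / −0.4307731, beating the R2 floors −1.2475882 / −0.7721153 / −0.4370756)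
give TIGHTER kinetic FLOORS `k(U) ≥ elo_R3 − U·hi`; (ii) the R3-base direct docc floors `sdp_corr_TL_hubSQ_w3_U{4,8}_R3b4eom_ob3p_Dlo`
(j072515 / j071290; D ≥ 0.0899086 / 0.0405710) give kinetic CEILINGS `k(U) ≤ u_U − U·lo` = −1.1922613 / −0.8208864 that BEAT the direct
`_Kup` rows (−1.1908485 / −0.8197005, j072301 / j072296). The gen-104 theorems stay valid (weaker); the best certified kinetic brackets are now
k(2) ∈ [−1.7118981, −1.4371337], k(6) ∈ [−1.6295727, −0.9802585], k(12) ∈ [−1.1408590, −0.6066459] (floors here, ceilings gen 104),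
k(4) ≤ −1.1922613 (here; floor −1.5915352 = row `_Klo` j072299), k(8) ≤ −0.8208864 (here; floor −1.3645310 = row `_Klo` j072294).
Rationals EXACT (`mk_trailer_g105.py`; kernel re-derives them via `push_cast; linarith`). Hypotheses as in gen 104. -/

section Gen105KineticCorollariesR3
/-- KINETIC energy density FLOOR at `U = 2` (R3-base): certified docc CEILING (row `sdp_corr_TL_hubSQ_w3_U2_R2b4eom_ob5p2_Dup`, `hi = 140566806143677769834189/604462909807314587353088`) +
the NEW R3-base TL energy FLOOR (row `sdp_lower_TL_hubSQ_w3_U2_R3b4eom_ob3p`, kit j071226, `elo = -1507290508743246646531007/1208925819614629174706176`) + the energy hypothesis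
`e(1,2,1) ≤ u_2` (unlocks the docc row): for every torus-limit half-filled ground state `ω`, `k_ω ≥ elo − 2·hi = -2069557733317957725867763/1208925819614629174706176 ≈ -1.7118980`
(outward `≥ -1.7118981`; supersedes the gen-104 floor built on the R2 energy row). Glue: `IsTorusLimitOf.neg_t_mul_re_expect_hoppingWindow_ge_of_docc_le`. -/
theorem kinetic2D_1_2_ge_fromDup_R3 (hrow : sdp_corr_TL_hubSQ_w3_U2_R2b4eom_ob5p2_Dup) (helo : sdp_lower_TL_hubSQ_w3_U2_R3b4eom_ob3p)
    (hu : ThermodynamicLimit.energyDensity2D 1 2 1 ≤ ((-79674784229/68719476736 : ℚ) : ℝ))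
    (ω : InfVolFermionState 2) (Ls : ℕ → ℕ) (ψ : ∀ L, Fock (Orb (FermionTorus 2 L)))
    (hLs : Tendsto Ls atTop atTop) (hev : ∀ j, Even (Ls j))
    (hψ : ∀ j, IsGroundState (hamiltonian (fermionTorusGraph 2 (Ls j)) 1 2) (Ls j ^ 2) (ψ (Ls j)))
    (h1 : ∀ j, star (ψ (Ls j)) ⬝ᵥ ψ (Ls j) = 1) (hω : ω.IsTorusLimitOf ψ Ls) :
    ((-2069557733317957725867763/1208925819614629174706176 : ℚ) : ℝ) ≤ -1 * (ω.expect ({0, unitVec 0, unitVec 1} : Finset (Site 2))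
        (∑ i : Fin 2, ∑ σ : Fin 2,
          ((cAt 0 zero_mem_kineticWindow σ)ᴴ * cAt (unitVec i) (unitVec_mem_kineticWindow i) σ +
            (cAt (unitVec i) (unitVec_mem_kineticWindow i) σ)ᴴ * cAt 0 zero_mem_kineticWindow σ))).re := by
  have hhi' := hrow ω Ls ψ hLs hev hψ h1 hω hu
  rw [map_neg, Complex.neg_re] at hhi'
  have hhi : (ω.expect ({0} : Finset (Site 2))
      (nAt 0 (Finset.mem_singleton_self (0 : Site 2)) 0 * nAt 0 (Finset.mem_singleton_self (0 : Site 2)) 1)).re ≤ ((140566806143677769834189/604462909807314587353088 : ℚ) : ℝ) := by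
    push_cast at hhi' ⊢; linarith
  have h := hω.neg_t_mul_re_expect_hoppingWindow_ge_of_docc_le hLs hev 1 (by norm_num) hψ h1 helo hhi
  push_cast at h ⊢
  linarith

/-- KINETIC energy density FLOOR at `U = 6` (R3-base): certified docc CEILING (row `sdp_corr_TL_hubSQ_w3_U6_R2b4eom_ob5p2_Dup`, `hi = 175817501588588701045419/1208925819614629174706176`) +
the NEW R3-base TL energy FLOOR (row `sdp_lower_TL_hubSQ_w3_U6_R3b4eom_ob3p`, kit j071227, `elo = -228781889641874769342351/302231454903657293676544`) + the energy hypothesis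
`e(1,6,1) ≤ u_6` (unlocks the docc row): for every torus-limit half-filled ground state `ω`, `k_ω ≥ elo − 6·hi = -985016284049515641820959/604462909807314587353088 ≈ -1.6295727`
(outward `≥ -1.6295728`; supersedes the gen-104 floor built on the R2 energy row). Glue: `IsTorusLimitOf.neg_t_mul_re_expect_hoppingWindow_ge_of_docc_le`. -/
theorem kinetic2D_1_6_ge_fromDup_R3 (hrow : sdp_corr_TL_hubSQ_w3_U6_R2b4eom_ob5p2_Dup) (helo : sdp_lower_TL_hubSQ_w3_U6_R3b4eom_ob3p)
    (hu : ThermodynamicLimit.energyDensity2D 1 6 1 ≤ ((-43100268505/68719476736 : ℚ) : ℝ))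
    (ω : InfVolFermionState 2) (Ls : ℕ → ℕ) (ψ : ∀ L, Fock (Orb (FermionTorus 2 L)))
    (hLs : Tendsto Ls atTop atTop) (hev : ∀ j, Even (Ls j))
    (hψ : ∀ j, IsGroundState (hamiltonian (fermionTorusGraph 2 (Ls j)) 1 6) (Ls j ^ 2) (ψ (Ls j)))
    (h1 : ∀ j, star (ψ (Ls j)) ⬝ᵥ ψ (Ls j) = 1) (hω : ω.IsTorusLimitOf ψ Ls) :
    ((-985016284049515641820959/604462909807314587353088 : ℚ) : ℝ) ≤ -1 * (ω.expect ({0, unitVec 0, unitVec 1} : Finset (Site 2))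
        (∑ i : Fin 2, ∑ σ : Fin 2,
          ((cAt 0 zero_mem_kineticWindow σ)ᴴ * cAt (unitVec i) (unitVec_mem_kineticWindow i) σ +
            (cAt (unitVec i) (unitVec_mem_kineticWindow i) σ)ᴴ * cAt 0 zero_mem_kineticWindow σ))).re := by
  have hhi' := hrow ω Ls ψ hLs hev hψ h1 hω hu
  rw [map_neg, Complex.neg_re] at hhi'
  have hhi : (ω.expect ({0} : Finset (Site 2))
      (nAt 0 (Finset.mem_singleton_self (0 : Site 2)) 0 * nAt 0 (Finset.mem_singleton_self (0 : Site 2)) 1)).re ≤ ((175817501588588701045419/1208925819614629174706176 : ℚ) : ℝ) := by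
    push_cast at hhi' ⊢; linarith
  have h := hω.neg_t_mul_re_expect_hoppingWindow_ge_of_docc_le hLs hev 1 (by norm_num) hψ h1 helo hhi
  push_cast at h ⊢
  linarith

/-- KINETIC energy density FLOOR at `U = 12` (R3-base): certified docc CEILING (row `sdp_corr_TL_hubSQ_w3_U12_R2b4eom_ob5p2_Dup`, `hi = 71536769975309770094295/1208925819614629174706176`) +
the NEW R3-base TL energy FLOOR (row `sdp_lower_TL_hubSQ_w3_U12_R3b4eom_ob3p`, kit j071228, `elo = -520772724574715421798181/1208925819614629174706176`) + the energy hypothesis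
`e(1,12,1) ≤ u_12` (unlocks the docc row): for every torus-limit half-filled ground state `ω`, `k_ω ≥ elo − 12·hi = -1379213964278432662929721/1208925819614629174706176 ≈ -1.1408591`
(outward `≥ -1.1408591`; supersedes the gen-104 floor built on the R2 energy row). Glue: `IsTorusLimitOf.neg_t_mul_re_expect_hoppingWindow_ge_of_docc_le`. -/
theorem kinetic2D_1_12_ge_fromDup_R3 (hrow : sdp_corr_TL_hubSQ_w3_U12_R2b4eom_ob5p2_Dup) (helo : sdp_lower_TL_hubSQ_w3_U12_R3b4eom_ob3p)
    (hu : ThermodynamicLimit.energyDensity2D 1 12 1 ≤ ((-2971620875/8589934592 : ℚ) : ℝ))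
    (ω : InfVolFermionState 2) (Ls : ℕ → ℕ) (ψ : ∀ L, Fock (Orb (FermionTorus 2 L)))
    (hLs : Tendsto Ls atTop atTop) (hev : ∀ j, Even (Ls j))
    (hψ : ∀ j, IsGroundState (hamiltonian (fermionTorusGraph 2 (Ls j)) 1 12) (Ls j ^ 2) (ψ (Ls j)))
    (h1 : ∀ j, star (ψ (Ls j)) ⬝ᵥ ψ (Ls j) = 1) (hω : ω.IsTorusLimitOf ψ Ls) :
    ((-1379213964278432662929721/1208925819614629174706176 : ℚ) : ℝ) ≤ -1 * (ω.expect ({0, unitVec 0, unitVec 1} : Finset (Site 2))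
        (∑ i : Fin 2, ∑ σ : Fin 2,
          ((cAt 0 zero_mem_kineticWindow σ)ᴴ * cAt (unitVec i) (unitVec_mem_kineticWindow i) σ +
            (cAt (unitVec i) (unitVec_mem_kineticWindow i) σ)ᴴ * cAt 0 zero_mem_kineticWindow σ))).re := by
  have hhi' := hrow ω Ls ψ hLs hev hψ h1 hω hu
  rw [map_neg, Complex.neg_re] at hhi'
  have hhi : (ω.expect ({0} : Finset (Site 2))
      (nAt 0 (Finset.mem_singleton_self (0 : Site 2)) 0 * nAt 0 (Finset.mem_singleton_self (0 : Site 2)) 1)).re ≤ ((71536769975309770094295/1208925819614629174706176 : ℚ) : ℝ) := by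
    push_cast at hhi' ⊢; linarith
  have h := hω.neg_t_mul_re_expect_hoppingWindow_ge_of_docc_le hLs hev 1 (by norm_num) hψ h1 helo hhi
  push_cast at h ⊢
  linarith

/-- KINETIC energy density CEILING at `U = 4` (R3-base): certified direct docc FLOOR (row `sdp_corr_TL_hubSQ_w3_U4_R3b4eom_ob3p_Dlo`, kit j072515, `lo = 108692780160874342166499/1208925819614629174706176`)
+ the energy hypothesis `e(1,4,1) ≤ u_4 = -28608848529/34359738368`: for every torus-limit half-filled ground state `ω`,
`k_ω ≤ u_4 − 4·lo = -360338873080216847298531/302231454903657293676544 ≈ -1.1922613` (outward `≤ -1.1922613`), which BEATS the direct row `sdp_corr_TL_hubSQ_w3_U4_R2b4eom_ob5p2_Kup`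
(`k_ω ≤ -719823728618050315304735/604462909807314587353088 ≈ -1.1908485`). Glue: `IsTorusLimitOf.neg_t_mul_re_expect_hoppingWindow_le_of_le_docc`. -/
theorem kinetic2D_1_4_le_fromDlo_R3 (hrow : sdp_corr_TL_hubSQ_w3_U4_R3b4eom_ob3p_Dlo)
    (hu : ThermodynamicLimit.energyDensity2D 1 4 1 ≤ ((-28608848529/34359738368 : ℚ) : ℝ))
    (ω : InfVolFermionState 2) (Ls : ℕ → ℕ) (ψ : ∀ L, Fock (Orb (FermionTorus 2 L)))
    (hLs : Tendsto Ls atTop atTop) (hev : ∀ j, Even (Ls j))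
    (hψ : ∀ j, IsGroundState (hamiltonian (fermionTorusGraph 2 (Ls j)) 1 4) (Ls j ^ 2) (ψ (Ls j)))
    (h1 : ∀ j, star (ψ (Ls j)) ⬝ᵥ ψ (Ls j) = 1) (hω : ω.IsTorusLimitOf ψ Ls) :
    -1 * (ω.expect ({0, unitVec 0, unitVec 1} : Finset (Site 2))
        (∑ i : Fin 2, ∑ σ : Fin 2,
          ((cAt 0 zero_mem_kineticWindow σ)ᴴ * cAt (unitVec i) (unitVec_mem_kineticWindow i) σ +
            (cAt (unitVec i) (unitVec_mem_kineticWindow i) σ)ᴴ * cAt 0 zero_mem_kineticWindow σ))).re ≤ ((-360338873080216847298531/302231454903657293676544 : ℚ) : ℝ) := by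
  have hlo := hrow ω Ls ψ hLs hev hψ h1 hω hu
  have h := hω.neg_t_mul_re_expect_hoppingWindow_le_of_le_docc hLs hev 1 (by norm_num) hψ h1 hu hlo
  push_cast at h ⊢
  linarith

/-- KINETIC energy density CEILING at `U = 8` (R3-base): certified direct docc FLOOR (row `sdp_corr_TL_hubSQ_w3_U8_R3b4eom_ob3p_Dlo`, kit j071290, `lo = 24523642749332072328391/604462909807314587353088`)
+ the energy hypothesis `e(1,8,1) ≤ u_8 = -34106764425/68719476736`: for every torus-limit half-filled ground state `ω`,
`k_ω ≤ u_8 − 8·lo = -62024426820436390997191/75557863725914323419136 ≈ -0.8208865` (outward `≤ -0.8208864`), which BEATS the direct row `sdp_corr_TL_hubSQ_w3_U8_R2b4eom_ob5p2_Kup`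
(`k_ω ≤ -990957106214519295734795/1208925819614629174706176 ≈ -0.8197005`). Glue: `IsTorusLimitOf.neg_t_mul_re_expect_hoppingWindow_le_of_le_docc`. -/
theorem kinetic2D_1_8_le_fromDlo_R3 (hrow : sdp_corr_TL_hubSQ_w3_U8_R3b4eom_ob3p_Dlo)
    (hu : ThermodynamicLimit.energyDensity2D 1 8 1 ≤ ((-34106764425/68719476736 : ℚ) : ℝ))
    (ω : InfVolFermionState 2) (Ls : ℕ → ℕ) (ψ : ∀ L, Fock (Orb (FermionTorus 2 L)))
    (hLs : Tendsto Ls atTop atTop) (hev : ∀ j, Even (Ls j))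
    (hψ : ∀ j, IsGroundState (hamiltonian (fermionTorusGraph 2 (Ls j)) 1 8) (Ls j ^ 2) (ψ (Ls j)))
    (h1 : ∀ j, star (ψ (Ls j)) ⬝ᵥ ψ (Ls j) = 1) (hω : ω.IsTorusLimitOf ψ Ls) :
    -1 * (ω.expect ({0, unitVec 0, unitVec 1} : Finset (Site 2))
        (∑ i : Fin 2, ∑ σ : Fin 2,
          ((cAt 0 zero_mem_kineticWindow σ)ᴴ * cAt (unitVec i) (unitVec_mem_kineticWindow i) σ +
            (cAt (unitVec i) (unitVec_mem_kineticWindow i) σ)ᴴ * cAt 0 zero_mem_kineticWindow σ))).re ≤ ((-62024426820436390997191/75557863725914323419136 : ℚ) : ℝ) := by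
  have hlo := hrow ω Ls ψ hLs hev hψ h1 hω hu
  have h := hω.neg_t_mul_re_expect_hoppingWindow_le_of_le_docc hLs hev 1 (by norm_num) hψ h1 hu hlo
  push_cast at h ⊢
  linarith

end Gen105KineticCorollariesR3

/-! ## gen-111 bridge: the `_Klo/_Kup` rows stated on the kinetic window expression (typer g111, 2026-08-20)

Closes REFEREE items AK3/AL3. The lit seat's p206354 (commit f71236242963, `HubbardKineticEnergyDensity.lean`) landed
`InfVolFermionState.re_expect_hoppingWords_two`: for ANY state `ω`, any rational `q` and any membership proofs,
`Re ω(q•c†_{0↑}c_{e₂↑} + q•c†_{0↑}c_{e₁↑} + … + q•c†_{e₁↓}c_{0↓})` (the 8 words in the rows' order and bracketing)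
`= q · Re ω(Σ_i Σ_σ (c†_{0σ}c_{e_iσ} + c†_{e_iσ}c_{0σ}))`. Since `cNN i σ` is an abbreviation for `cAt _ _ σ` and membership proofs are
proof-irrelevant, the rows' `cNN` polynomial IS the tree's polynomial (`kineticWindow_eq_cNN` below is the operator-level identity, proved by
`Fin.sum_univ_two` + `abel`), so the direct kinetic rows 102–104/106 (`sdp_corr_TL_hubSQ_w3_U{4,8}_R2b4eom_ob5p2_{Klo,Kup}`) are restated here on
the SAME window expression `k_ω = −1 · Re ω_{{0,e₁,e₂}}(Σ_i Σ_σ …)` used by the gen-104/105 corollaries: a `_Klo` row (`q = −1`) gives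
`c ≤ Re ω(poly_{−1}) = −Re ω(window) = k_ω`, a `_Kup` row (`q = 1`) gives `c ≤ Re ω(poly_{1}) = Re ω(window) = −k_ω`, i.e. `k_ω ≤ −c`.
Every theorem below is fully proved (zero admits); hypotheses = the row Prop (certificate-backed, statement level) + the row's own binders.
Best certified direct brackets now in ONE syntactic form: `k(4) ∈ [−1.5915352 (row 102), −1.1908485 (row 104)]`, `k(8) ∈ [−1.3645310 (row 106),
−0.8197005 (row 103)]` (the R3-derived ceilings of gen 105, −1.1922613 / −0.8208864, remain the best ceilings). -/

section Gen111KineticBridge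

/-- Operator-level bridge (AK3/AL3): the rows' 8-word `cNN` kinetic polynomial with coefficient `a` equals `a •` the tree's window hopping
operator `Σ_{i : Fin 2} Σ_{σ : Fin 2} (c†_{0σ}c_{e_iσ} + c†_{e_iσ}c_{0σ})` (same element of `FermionOp nnSupport`; `cNN` unfolds, membership
proofs are irrelevant). -/
theorem kineticWindow_eq_cNN (a : ℚ) :
    ((a : ℚ) : ℂ) • ((cNN 0 0)ᴴ * cNN 2 0) +
      ((a : ℚ) : ℂ) • ((cNN 0 0)ᴴ * cNN 1 0) +
      ((a : ℚ) : ℂ) • ((cNN 0 1)ᴴ * cNN 2 1) +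
      ((a : ℚ) : ℂ) • ((cNN 0 1)ᴴ * cNN 1 1) +
      ((a : ℚ) : ℂ) • ((cNN 2 0)ᴴ * cNN 0 0) +
      ((a : ℚ) : ℂ) • ((cNN 2 1)ᴴ * cNN 0 1) +
      ((a : ℚ) : ℂ) • ((cNN 1 0)ᴴ * cNN 0 0) +
      ((a : ℚ) : ℂ) • ((cNN 1 1)ᴴ * cNN 0 1) =
    ((a : ℚ) : ℂ) • ∑ i : Fin 2, ∑ σ : Fin 2,
      ((cAt 0 zero_mem_kineticWindow σ)ᴴ * cAt (unitVec i) (unitVec_mem_kineticWindow i) σ +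
        (cAt (unitVec i) (unitVec_mem_kineticWindow i) σ)ᴴ * cAt 0 zero_mem_kineticWindow σ) := by
  simp only [Fin.sum_univ_two, smul_add]
  abel

/-- State-level bridge (any `ω`, coefficient `a`): `Re ω_{nnSupport}(cNN polynomial with coefficient a) = a · Re ω(window hopping operator)`
(same proof as the tree's `InfVolFermionState.re_expect_hoppingWords_two`, p206354, replayed locally through `kineticWindow_eq_cNN` so the staged file does not depend on the farm having rebuilt p206354's olean; interchangeable with `ω.re_expect_hoppingWords_two a zero_mem_kineticWindow unitVec_mem_kineticWindow` once it has). -/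
theorem re_expect_cNN_kinetic_eq (ω : InfVolFermionState 2) (a : ℚ) :
    (ω.expect nnSupport
        (((a : ℚ) : ℂ) • ((cNN 0 0)ᴴ * cNN 2 0) +
        ((a : ℚ) : ℂ) • ((cNN 0 0)ᴴ * cNN 1 0) +
        ((a : ℚ) : ℂ) • ((cNN 0 1)ᴴ * cNN 2 1) +
        ((a : ℚ) : ℂ) • ((cNN 0 1)ᴴ * cNN 1 1) +
        ((a : ℚ) : ℂ) • ((cNN 2 0)ᴴ * cNN 0 0) +
        ((a : ℚ) : ℂ) • ((cNN 2 1)ᴴ * cNN 0 1) +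
        ((a : ℚ) : ℂ) • ((cNN 1 0)ᴴ * cNN 0 0) +
        ((a : ℚ) : ℂ) • ((cNN 1 1)ᴴ * cNN 0 1))).re =
      a * (ω.expect ({0, unitVec 0, unitVec 1} : Finset (Site 2))
        (∑ i : Fin 2, ∑ σ : Fin 2,
          ((cAt 0 zero_mem_kineticWindow σ)ᴴ * cAt (unitVec i) (unitVec_mem_kineticWindow i) σ +
            (cAt (unitVec i) (unitVec_mem_kineticWindow i) σ)ᴴ * cAt 0 zero_mem_kineticWindow σ))).re := by
  rw [kineticWindow_eq_cNN, map_smul, smul_eq_mul, ← Complex.ofReal_ratCast, Complex.re_ofReal_mul]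

/-- KINETIC energy density FLOOR at `U = 4` = row 102 (`sdp_corr_TL_hubSQ_w3_U4_R2b4eom_ob5p2_Klo`, kit j072299) restated on the window expression: for every torus-limit half-filled ground state `ω`, GIVEN `e(1,4,1) ≤ u_4 = -28608848529/34359738368`, `k_ω ≥ -1924048027978610123364929/1208925819614629174706176 ≈ -1.5915352`. Bridge: `re_expect_cNN_kinetic_eq` with `a = -1` (p206354). -/
theorem kinetic2D_1_4_ge_fromKlo (hrow : sdp_corr_TL_hubSQ_w3_U4_R2b4eom_ob5p2_Klo)
    (hu : ThermodynamicLimit.energyDensity2D 1 4 1 ≤ ((-28608848529/34359738368 : ℚ) : ℝ))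
    (ω : InfVolFermionState 2) (Ls : ℕ → ℕ) (ψ : ∀ L, Fock (Orb (FermionTorus 2 L)))
    (hLs : Tendsto Ls atTop atTop) (hev : ∀ j, Even (Ls j))
    (hψ : ∀ j, IsGroundState (hamiltonian (fermionTorusGraph 2 (Ls j)) 1 4) (Ls j ^ 2) (ψ (Ls j)))
    (h1 : ∀ j, star (ψ (Ls j)) ⬝ᵥ ψ (Ls j) = 1) (hω : ω.IsTorusLimitOf ψ Ls) :
    ((-1924048027978610123364929/1208925819614629174706176 : ℚ) : ℝ) ≤ -1 * (ω.expect ({0, unitVec 0, unitVec 1} : Finset (Site 2))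
        (∑ i : Fin 2, ∑ σ : Fin 2,
          ((cAt 0 zero_mem_kineticWindow σ)ᴴ * cAt (unitVec i) (unitVec_mem_kineticWindow i) σ +
            (cAt (unitVec i) (unitVec_mem_kineticWindow i) σ)ᴴ * cAt 0 zero_mem_kineticWindow σ))).re := by
  have h := hrow ω Ls ψ hLs hev hψ h1 hω hu
  rw [re_expect_cNN_kinetic_eq ω (-1)] at h
  push_cast at h ⊢
  linarith

/-- KINETIC energy density CEILING at `U = 8` = row 103 (`sdp_corr_TL_hubSQ_w3_U8_R2b4eom_ob5p2_Kup`, kit j072296) restated on the window expression: for every torus-limit half-filled ground state `ω`, GIVEN `e(1,8,1) ≤ u_8 = -34106764425/68719476736`, `k_ω ≤ -990957106214519295734795/1208925819614629174706176 ≈ -0.8197005`. Bridge: `re_expect_cNN_kinetic_eq` with `a = 1` (p206354). -/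
theorem kinetic2D_1_8_le_fromKup (hrow : sdp_corr_TL_hubSQ_w3_U8_R2b4eom_ob5p2_Kup)
    (hu : ThermodynamicLimit.energyDensity2D 1 8 1 ≤ ((-34106764425/68719476736 : ℚ) : ℝ))
    (ω : InfVolFermionState 2) (Ls : ℕ → ℕ) (ψ : ∀ L, Fock (Orb (FermionTorus 2 L)))
    (hLs : Tendsto Ls atTop atTop) (hev : ∀ j, Even (Ls j))
    (hψ : ∀ j, IsGroundState (hamiltonian (fermionTorusGraph 2 (Ls j)) 1 8) (Ls j ^ 2) (ψ (Ls j)))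
    (h1 : ∀ j, star (ψ (Ls j)) ⬝ᵥ ψ (Ls j) = 1) (hω : ω.IsTorusLimitOf ψ Ls) :
    -1 * (ω.expect ({0, unitVec 0, unitVec 1} : Finset (Site 2))
        (∑ i : Fin 2, ∑ σ : Fin 2,
          ((cAt 0 zero_mem_kineticWindow σ)ᴴ * cAt (unitVec i) (unitVec_mem_kineticWindow i) σ +
            (cAt (unitVec i) (unitVec_mem_kineticWindow i) σ)ᴴ * cAt 0 zero_mem_kineticWindow σ))).re ≤ ((-990957106214519295734795/1208925819614629174706176 : ℚ) : ℝ) := by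
  have h := hrow ω Ls ψ hLs hev hψ h1 hω hu
  rw [re_expect_cNN_kinetic_eq ω (1)] at h
  push_cast at h ⊢
  linarith

/-- KINETIC energy density CEILING at `U = 4` = row 104 (`sdp_corr_TL_hubSQ_w3_U4_R2b4eom_ob5p2_Kup`, kit j072301) restated on the window expression: for every torus-limit half-filled ground state `ω`, GIVEN `e(1,4,1) ≤ u_4 = -28608848529/34359738368`, `k_ω ≤ -719823728618050315304735/604462909807314587353088 ≈ -1.1908485`. Bridge: `re_expect_cNN_kinetic_eq` with `a = 1` (p206354). -/
theorem kinetic2D_1_4_le_fromKup (hrow : sdp_corr_TL_hubSQ_w3_U4_R2b4eom_ob5p2_Kup)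
    (hu : ThermodynamicLimit.energyDensity2D 1 4 1 ≤ ((-28608848529/34359738368 : ℚ) : ℝ))
    (ω : InfVolFermionState 2) (Ls : ℕ → ℕ) (ψ : ∀ L, Fock (Orb (FermionTorus 2 L)))
    (hLs : Tendsto Ls atTop atTop) (hev : ∀ j, Even (Ls j))
    (hψ : ∀ j, IsGroundState (hamiltonian (fermionTorusGraph 2 (Ls j)) 1 4) (Ls j ^ 2) (ψ (Ls j)))
    (h1 : ∀ j, star (ψ (Ls j)) ⬝ᵥ ψ (Ls j) = 1) (hω : ω.IsTorusLimitOf ψ Ls) :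
    -1 * (ω.expect ({0, unitVec 0, unitVec 1} : Finset (Site 2))
        (∑ i : Fin 2, ∑ σ : Fin 2,
          ((cAt 0 zero_mem_kineticWindow σ)ᴴ * cAt (unitVec i) (unitVec_mem_kineticWindow i) σ +
            (cAt (unitVec i) (unitVec_mem_kineticWindow i) σ)ᴴ * cAt 0 zero_mem_kineticWindow σ))).re ≤ ((-719823728618050315304735/604462909807314587353088 : ℚ) : ℝ) := by
  have h := hrow ω Ls ψ hLs hev hψ h1 hω hu
  rw [re_expect_cNN_kinetic_eq ω (1)] at h
  push_cast at h ⊢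
  linarith

/-- KINETIC energy density FLOOR at `U = 8` = row 106 (`sdp_corr_TL_hubSQ_w3_U8_R2b4eom_ob5p2_Klo`, kit j072294) restated on the window expression: for every torus-limit half-filled ground state `ω`, GIVEN `e(1,8,1) ≤ u_8 = -34106764425/68719476736`, `k_ω ≥ -824808339316231879308789/604462909807314587353088 ≈ -1.3645309`. Bridge: `re_expect_cNN_kinetic_eq` with `a = -1` (p206354). -/
theorem kinetic2D_1_8_ge_fromKlo (hrow : sdp_corr_TL_hubSQ_w3_U8_R2b4eom_ob5p2_Klo)
    (hu : ThermodynamicLimit.energyDensity2D 1 8 1 ≤ ((-34106764425/68719476736 : ℚ) : ℝ))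
    (ω : InfVolFermionState 2) (Ls : ℕ → ℕ) (ψ : ∀ L, Fock (Orb (FermionTorus 2 L)))
    (hLs : Tendsto Ls atTop atTop) (hev : ∀ j, Even (Ls j))
    (hψ : ∀ j, IsGroundState (hamiltonian (fermionTorusGraph 2 (Ls j)) 1 8) (Ls j ^ 2) (ψ (Ls j)))
    (h1 : ∀ j, star (ψ (Ls j)) ⬝ᵥ ψ (Ls j) = 1) (hω : ω.IsTorusLimitOf ψ Ls) :
    ((-824808339316231879308789/604462909807314587353088 : ℚ) : ℝ) ≤ -1 * (ω.expect ({0, unitVec 0, unitVec 1} : Finset (Site 2))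
        (∑ i : Fin 2, ∑ σ : Fin 2,
          ((cAt 0 zero_mem_kineticWindow σ)ᴴ * cAt (unitVec i) (unitVec_mem_kineticWindow i) σ +
            (cAt (unitVec i) (unitVec_mem_kineticWindow i) σ)ᴴ * cAt 0 zero_mem_kineticWindow σ))).re := by
  have h := hrow ω Ls ψ hLs hev hψ h1 hω hu
  rw [re_expect_cNN_kinetic_eq ω (-1)] at h
  push_cast at h ⊢
  linarith

end Gen111KineticBridge

end Summit.HubbardSuperconductivity.ManyBodyBootstrap.Bounds

end
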